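import Summits.CriticalPhenomena.PercolationContinuityZ3.Theorems.PercNearOneGluingNoHeavyPcintNawFreeMemKernelClaims
import HarnessLib

/-!
# PCINT lane, reduction B2d on the dangerous-set automaton — the witness-carrying (claims) kernel certificate: the theorem

Cell `prim-pcint` (PAPER-2 track (iii)), seat `prim-pcint-1` (gen 8); support file (`--supports stmt-CriticalPhenomena-4575`).
Does NOT build on p205010.  Memo: run/shared/lean/prim/pcint/REDUCTIONS.md §B2d; prim-pcint-1/gen8/README.md.

**`NawK.le_siteCriticalProb_of_checkRowsW`**: if every row `i < N` of a claims table (`NawK.WT`, `…NawFreeMemKernelClaims`) passes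
`NawK.checkRowW`, row `0` carries the empty state, the symmetry numbers denote lattice symmetries, the weight table is admissible,
`pn ≤ D`, `lamN < lamD`, `2 kt ≤ τ` and `2 ≤ kt`, then `pn / D ≤ p_c^site(ℤ^d)` — the same statement as
`NawK.le_siteCriticalProb_of_checkRowsF` for the cheaper row check (the simulation part is verbatim; the Collatz–Wielandt rows use
`NawK.fwt_le_claimW` in place of the exact weight identity).
-/

namespace Summit.CriticalPhenomena.PercolationContinuityZ3.Theorems.Pcint

open Finset Literature.Probability.Percolation Literature.Probability.LatticeModels

namespace NawK

open WinK (toSite toL addL adjL toSite_addL toSite_toL adj_iff_adjL toSite_inj length_toL length_addL)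

variable {d : ℕ}

section SoundW

variable {τ kt d N pn D lamN lamD : ℕ} {QL : List ℕ} {syms : List (List (ℕ × Bool))} {wt : WT}

/-- **Soundness of the B2d kernel certificate with claims.**  If every row `i < N` passes `checkRowW`, row `0` carries the empty
state, the symmetry numbers denote lattice symmetries, the weight table is admissible, `pn ≤ D`, `lamN < lamD`, `2 kt ≤ τ`, `2 ≤ kt`,
then `pn / D ≤ p_c^site(ℤ^d)`. [folklore] -/
theorem le_siteCriticalProb_of_checkRowsW [NeZero d] (hτ : 2 ≤ τ) (hkt : 2 * kt ≤ τ) (hkt2 : 2 ≤ kt) (sym : ℕ → SPerm d)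
    (hsyms : ∀ c < syms.length, syms.getD c [] = spermKL (sym c))
    (hrows : ∀ i < N, checkRowW τ kt d N pn D lamN lamD QL syms wt i = true)
    (hN : 0 < N) (h0 : stOf wt.toNT 0 = []) (hD : 0 < D) (hpn : pn ≤ D) (hQ : QLok d pn D QL = true) (hlam : lamN < lamD) :
    (pn : ℝ) / D ≤ siteCriticalProb (zdGraph d) 0 := by
  classical
  have hDr : (0 : ℝ) < D := Nat.cast_pos.2 hD
  have hlamDr : (0 : ℝ) < lamD := Nat.cast_pos.2 (by omega)
  obtain ⟨hQle, hQmono, hQpow⟩ := QLok_spec (d := d) hQ hD hpn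
  set t : NT := wt.toNT with ht
  set p : unitInterval := ⟨(pn : ℝ) / D, div_nonneg (Nat.cast_nonneg _) hDr.le,
    div_le_one_of_le₀ (by exact_mod_cast hpn) hDr.le⟩ with hp
  set qv : ℕ → ℝ := fun k => (Qn D QL k : ℝ) / D with hqv
  set lam : ℝ := (lamN : ℝ) / lamD with hlamdef
  have hq0 : ∀ k, 0 ≤ qv k := fun k => div_nonneg (Nat.cast_nonneg _) hDr.le
  have hq1 : ∀ k, qv k ≤ 1 := fun k => div_le_one_of_le₀ (by exact_mod_cast hQle k) hDr.le
  have hmono : ∀ k k', k ≤ k' → qv k ≤ qv k' := fun k k' h =>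
    div_le_div_of_nonneg_right (by exact_mod_cast hQmono k k' h) hDr.le
  have hpq : ∀ k, k ≤ 2 * d → 1 - (p : ℝ) ≤ qv k ^ k := fun k hk => hQpow k hk
  have hlam0 : 0 ≤ lam := div_nonneg (Nat.cast_nonneg _) hlamDr.le
  have hlam1 : lam < 1 := (div_lt_one hlamDr).2 (by exact_mod_cast hlam)
  let R : Fin N → MState d := fun i => toM (stOf t i)
  let V : Fin N → ℝ := fun i => (vOf t i : ℝ)
  let sc : Fin N → Fin d × Bool → Option (Fin N × SPerm d) := fun i a =>
    match scOf t i (letterIdx a) with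
    | none => none
    | some jc => if h : jc.1 < N then some ((⟨jc.1, h⟩ : Fin N), sym jc.2) else none
  have hrow : ∀ i : Fin N, ∃ v, wt.find i = some v ∧ WF d v.2.1 = true ∧ AOK v.2.1 = true ∧ 1 ≤ v.1 ∧
      (∀ a, termOK τ d N syms t v.2.1 a (v.2.2.1.getD (letterIdx a) none) = true) ∧
      (∀ a, claimsOK τ kt d (fKK d v.2.1 a) (v.2.2.2.getD (letterIdx a) ([], none)) = true) ∧
      lamD * rowValW d pn D QL wt (fun k => v.2.2.1.getD k none) (fun k => v.2.2.2.getD k ([], none)) ≤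
        lamN * 2 * D ^ (8 * d + 1) * v.1 :=
    fun i => checkRowW_spec (hrows i i.2)
  have hfind : ∀ (i : Fin N) v, wt.find i = some v → t.find i = some (v.1, v.2.1, v.2.2.1) := fun i v h => by
    rw [ht, WT.find_toNT, h]; rfl
  have hst : ∀ (i : Fin N) v, wt.find i = some v → stOf t i = v.2.1 := fun i v h => by simp [stOf, hfind i v h]
  have hv : ∀ (i : Fin N) v, wt.find i = some v → vOf t i = v.1 := fun i v h => by simp [vOf, hfind i v h]
  have hsc : ∀ (i : Fin N) v, wt.find i = some v → ∀ k, scOf t i k = v.2.2.1.getD k none := fun i v h k => by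
    simp [scOf, hfind i v h]
  have hV : ∀ i, 1 ≤ V i := fun i => by
    obtain ⟨v, hf, -, -, hv1, -⟩ := hrow i
    show (1 : ℝ) ≤ (vOf t i : ℝ)
    rw [hv i v hf]; exact_mod_cast hv1
  have h0' : R ⟨0, hN⟩ = ∅ := by
    show toM (stOf t 0) = (∅ : MState d)
    rw [h0]; rfl
  -- simulation (weight-independent; as in the `F` certificate)
  have hsim : ∀ i a, simRel R (nstep τ (R i) a) (sc i a) = true := by
    intro i a
    obtain ⟨v, hf, hwf, -, -, hok, -, -⟩ := hrow i
    have hRi : R i = toM v.2.1 := by show toM (stOf t i) = _; rw [hst i v hf]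
    have hoka := hok a
    unfold termOK at hoka
    have hsci : sc i a = (match v.2.2.1.getD (letterIdx a) none with
        | none => none
        | some jc => if h : jc.1 < N then some ((⟨jc.1, h⟩ : Fin N), sym jc.2) else none) := by
      show (match scOf t i (letterIdx a) with
        | none => none
        | some jc => if h : jc.1 < N then some ((⟨jc.1, h⟩ : Fin N), sym jc.2) else none) = _
      rw [hsc i v hf]
    rw [hRi, nstep_toM hwf, hsci]
    cases hT : nstepK τ d v.2.1 a with
    | none =>
      rw [hT] at hoka
      cases hos : v.2.2.1.getD (letterIdx a) none with
      | none => rfl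
      | some jc => rw [hos] at hoka; exact Bool.noConfusion hoka
    | some T =>
      rw [hT] at hoka
      cases hos : v.2.2.1.getD (letterIdx a) none with
      | none => rw [hos] at hoka; exact Bool.noConfusion hoka
      | some jc =>
        rw [hos] at hoka
        rcases jc with ⟨j, c⟩
        simp only [Bool.and_eq_true, decide_eq_true_eq] at hoka
        obtain ⟨⟨hjN, hc⟩, hseq⟩ := hoka
        simp only [Option.map_some, dif_pos hjN, simRel, decide_eq_true_eq]
        rw [toM_eq_of_seteqK hseq, hsyms c hc, toM_actK]
  -- Collatz–Wielandt rows on the claimed weights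
  have hcw : ∀ i, (∑ a : Fin d × Bool, match sc i a with
      | none => 0
      | some jg => (p : ℝ) * fwt τ kt qv (R i) a * V jg.1) ≤ lam * V i := by
    intro i
    obtain ⟨v, hf, hwf, hA, hv1, hok, hcl, hineq⟩ := hrow i
    have hRi : R i = toM v.2.1 := by show toM (stOf t i) = _; rw [hst i v hf]
    have hterm : ∀ a, (match sc i a with
        | none => 0
        | some jg => (p : ℝ) * fwt τ kt qv (R i) a * V jg.1) ≤
        (termValW d pn D QL wt (v.2.2.1.getD (letterIdx a) none) (v.2.2.2.getD (letterIdx a) ([], none)) : ℝ) /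
          (2 * (D : ℝ) ^ (8 * d + 1)) := by
      intro a
      have hoka := hok a
      unfold termOK at hoka
      have hsci : sc i a = (match v.2.2.1.getD (letterIdx a) none with
          | none => none
          | some jc => if h : jc.1 < N then some ((⟨jc.1, h⟩ : Fin N), sym jc.2) else none) := by
        show (match scOf t i (letterIdx a) with
          | none => none
          | some jc => if h : jc.1 < N then some ((⟨jc.1, h⟩ : Fin N), sym jc.2) else none) = _
        rw [hsc i v hf]
      rw [hsci]
      cases hos : v.2.2.1.getD (letterIdx a) none with
      | none => simp only [termValW, Nat.cast_zero, zero_div, le_refl]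
      | some jc =>
        rw [hos] at hoka
        cases hT : nstepK τ d v.2.1 a with
        | none => rw [hT] at hoka; exact Bool.noConfusion hoka
        | some T =>
          rw [hT] at hoka
          rcases jc with ⟨j, c⟩
          simp only [Bool.and_eq_true, decide_eq_true_eq] at hoka
          obtain ⟨⟨hjN, -⟩, -⟩ := hoka
          simp only [dif_pos hjN, termValW]
          rw [termValF_real_eq hDr]
          have hVj : V ⟨j, hjN⟩ = (vOf t j : ℝ) := rfl
          rw [hVj, hRi]
          have hpv : (p : ℝ) = (pn : ℝ) / D := rfl
          rw [hpv]
          have hw := fwt_le_claimW (τ := τ) (kt := kt) hDr hQle hQmono hwf hA a (hcl a)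
          have hVn : (0 : ℝ) ≤ (vOf t j : ℝ) := Nat.cast_nonneg _
          have hpn0 : (0 : ℝ) ≤ (pn : ℝ) / D := div_nonneg (Nat.cast_nonneg _) hDr.le
          calc (pn : ℝ) / D * fwt τ kt qv (toM v.2.1) a * (vOf t j : ℝ)
              ≤ (pn : ℝ) / D * ((uNumW d D QL (v.2.2.2.getD (letterIdx a) ([], none)).1 : ℝ) / (D : ℝ) ^ (4 * d) *
                  ((fNumW d D QL (v.2.2.2.getD (letterIdx a) ([], none)).2 : ℝ) / (2 * (D : ℝ) ^ (4 * d)))) *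
                  (vOf t j : ℝ) :=
                mul_le_mul_of_nonneg_right (mul_le_mul_of_nonneg_left hw hpn0) hVn
            _ = _ := by rw [ht]; ring
    calc (∑ a : Fin d × Bool, match sc i a with
            | none => 0
            | some jg => (p : ℝ) * fwt τ kt qv (R i) a * V jg.1)
        ≤ ∑ a : Fin d × Bool, (termValW d pn D QL wt (v.2.2.1.getD (letterIdx a) none)
            (v.2.2.2.getD (letterIdx a) ([], none)) : ℝ) / (2 * (D : ℝ) ^ (8 * d + 1)) :=
          Finset.sum_le_sum fun a _ => hterm a
      _ = (rowValW d pn D QL wt (fun k => v.2.2.1.getD k none) (fun k => v.2.2.2.getD k ([], none)) : ℝ) /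
            (2 * (D : ℝ) ^ (8 * d + 1)) := by
          rw [← Finset.sum_div, rowValW, ← sum_letters_eq, Nat.cast_list_sum, List.map_map]; rfl
      _ ≤ lam * V i := by
          rw [div_le_iff₀ (by positivity), hlamdef]
          show _ ≤ (lamN : ℝ) / lamD * (vOf t i : ℝ) * (2 * (D : ℝ) ^ (8 * d + 1))
          rw [hv i v hf, div_mul_eq_mul_div, div_mul_eq_mul_div, le_div_iff₀ hlamDr]
          calc (rowValW d pn D QL wt (fun k => v.2.2.1.getD k none) (fun k => v.2.2.2.getD k ([], none)) : ℝ) * lamD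
              = ((lamD * rowValW d pn D QL wt (fun k => v.2.2.1.getD k none) (fun k => v.2.2.2.getD k ([], none)) : ℕ) :
                  ℝ) := by push_cast; ring
            _ ≤ ((lamN * 2 * D ^ (8 * d + 1) * v.1 : ℕ) : ℝ) := by exact_mod_cast hineq
            _ = (lamN : ℝ) * (v.1 : ℝ) * (2 * (D : ℝ) ^ (8 * d + 1)) := by push_cast; ring
  exact le_siteCriticalProb_zd_of_freeMemTable (d := d) hτ hkt hkt2 p hq0 hq1 hmono hpq hlam0 hlam1
    R sc V ⟨0, hN⟩ h0' hV hsim hcw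

end SoundW

end NawK

end Summit.CriticalPhenomena.PercolationContinuityZ3.Theorems.Pcint
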